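import Literature.Analysis.Calculus.LaplacianCommutatorCarreDuChamp   -- FILE 1 (this seat): the operator `L`, product rule, `∂_uL = L∂_u`, `[L, Γ]`, `[L, Γ₂]`
import HarnessLib

/-!
# The triple commutator of a flat weighted Laplacian with a cubic: `ad(L)³(P·) = 8·∂(D³P)` — Harish-Chandra's device behind `∂(p₃) = (1∕8)·ad(∂(ω))³(p₃)`
# (Harish-Chandra 1957, «Differential operators on a semisimple Lie algebra», Part I; Dieudonné VIII §12 — FILE 2 of ROAD A-IV brick (b2))

Topic `Analysis/Calculus`; namespace `Literature.Analysis.Calculus`.  THEOREMS ONLY (no `def`, no instance, no notation, no axiom, no named fact, no `sorry`).  Cell `pub/hodgecm-mathlib`,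
ENGINE T1 (crux H413 = `stmt-HodgeConjecture-24833`); ROAD «A6-IV» (DESIGN v2 93542b84 §1 (★2) «THE CUBIC EQUATION IS FREE GIVEN THE QUADRATIC ONE», SPEC fb65bd65 brick (b2)); owner F0P3a-p05
(g15) R-15.4∕R-15.5; author F0P3a-p09 (g2), 2026-09-01; reader ref4 (g0) 19:12:51Z «=» on the shape.  Consumer: (b3) `UnitBallLieAlgebraHCSystem` with `L := lieLaplacian`, `E := lieBasis`,
`w := lieWeight`, `P := invP₃` (for which `LP = 18 • invP₁` is LINEAR), and the 𝔧-side twin on `{rootProduct ≠ 0}` with the flat Laplacian of `ℝ³`.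

WHAT IS PROVED.  For `L` as in FILE 1 (operator variable + `hL`), `P : V → ℝ` smooth with `LP` AFFINE (`Σ_a w_a ∂_a∂_aP = ℓ + c`, `ℓ : V →L[ℝ] ℝ`), `φ` smooth on the open `U ∋ x`:
§4 **`weightedSecond_tripleCommutator_smul`** (nested-derivative form)
  `L(L(L(P·φ)))(x) − 3·L(L(P·Lφ))(x) + 3·L(P·L(Lφ))(x) − P(x)·L(L(Lφ))(x) = 8·Σ_{a,b,c} w_aw_bw_c (∂_c∂_b∂_aP)(x)·(∂_c∂_b∂_aφ)(x)`
— i.e. `ad(L)³(P·)` IS the constant-coefficient third-order operator `8·∂(D³P)`: from FILE 1, `ad(L)(P·) = 2Γ_P + (LP)·`, `ad(L)²(P·) = 4Γ₂(P,·) + 4Γ_{LP} + (L²P)·`, `ad(L)³(P·) = 8Γ₃(P,·) +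
12Γ₂(LP,·) + 6Γ_{L²P} + (L³P)·`, and the three tails vanish when `LP` is affine (the proof expands `L²(P·χ) = P·L²χ + 4Γ(P,Lχ) + 2(LP)·Lχ + 4Γ₂(P,χ) + 4Γ_ℓ(χ)` and `L³(P·φ)` termwise);
§5 **`weightedSecond_tripleCommutator_smul_iteratedFDeriv`** — the same with `hL : ∀ χ y, L χ y = Σ a, w a • iteratedFDeriv ℝ 2 χ y ![E a, E a]` (an operator given EVERYWHERE by the
`iteratedFDeriv` formula, as the (a0) `lieLaplacian`), `hLP` in `iteratedFDeriv ℝ 2` form and the conclusion with `iteratedFDeriv ℝ 3 P x ![E a, E b, E c]`, `iteratedFDeriv ℝ 3 φ x ![E a, E b, E c]`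
(such an `L` is local and agrees with the nested operator on functions smooth on `U`; `D³ψ(y)(u,v,w) = ∂_u∂_v∂_wψ(y)` there).  This is Harish-Chandra's route to the invariant CUBIC operator from the
Casimir: with `R(D)Φ_f := Φ_{Df}` multiplicative on words and `R(Δ_B) = π⁻¹Δ_𝔧∘π`, one gets `R(∂(D³P₃)) = (1∕8)·ad(R(Δ_B))³(R(P₃))`, computed on 𝔧 by the same identity.
HONEST LABEL: HC_CM is proved only modulo the printed citations until rung 0 closes; generic calculus, pays no row by itself.

## References
* [HarishChandra1957DiffOps] Harish-Chandra, *Differential operators on a semisimple Lie algebra*, Amer. J. Math. 79 (1957) 87–120, Part I — not held; cited for the device.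
* [Dieudonne1960] J. Dieudonné, *Foundations of Modern Analysis* (1960), Ch. VIII §12.
-/

set_option autoImplicit false

noncomputable section

open Filter Topology Set Function
open scoped ContDiff

namespace Literature.Analysis.Calculus

variable {V F : Type*} [NormedAddCommGroup V] [NormedSpace ℝ V] [NormedAddCommGroup F] [NormedSpace ℝ F]

/-! ## §4 THE TRIPLE COMMUTATOR: `ad(L)³(P·)φ = 8·Σ_{abc} w_a w_b w_c (∂_c∂_b∂_aP)(∂_c∂_b∂_aφ)` when `LP` is affine -/

section Triple

variable {n : ℕ} {E : Fin n → V} {w : Fin n → ℝ} {U : Set V}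

/-- **HARISH-CHANDRA'S TRIPLE COMMUTATOR (nested-derivative form).**  Let `L χ = Σ_a w_a ∂_{E_a}∂_{E_a}χ` (a flat second-order operator with constant coefficients, given through
`hL`), `P : V → ℝ` smooth with `LP` AFFINE (`Σ_a w_a ∂_a∂_aP = ℓ + c`), and `φ` smooth on the open `U ∋ x`.  Then
`L(L(L(P·φ)))(x) − 3·L(L(P·Lφ))(x) + 3·L(P·L(Lφ))(x) − P(x)·L(L(Lφ))(x) = 8·Σ_{a,b,c} w_a w_b w_c (∂_c∂_b∂_aP)(x)·(∂_c∂_b∂_aφ)(x)`: the operator `ad(L)³(P·)` is the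
constant-coefficient THIRD-order operator `8·∂(D³P)` — the device by which Harish-Chandra reaches `∂(p)` for the cubic invariant from the Casimir `∂(ω)` alone
(`ad(L)(P·) = 2Γ_P + (LP)·`, `ad(L)²(P·) = 4Γ₂(P,·) + 4Γ_{LP} + (L²P)·`, `ad(L)³(P·) = 8Γ₃(P,·) + 12Γ₂(LP,·) + 6Γ_{L²P} + (L³P)·`, and the last three vanish for `LP` affine).
[cite: HarishChandra1957DiffOps, §§2–3 (the `∂(ω)`-commutators)] [cite: Dieudonne1960, Ch. VIII §12] -/
theorem weightedSecond_tripleCommutator_smul (hU : IsOpen U) (L : (V → F) → V → F)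
    (hL : ∀ χ y, L χ y = ∑ a, w a • fderiv ℝ (fun z => fderiv ℝ χ z (E a)) y (E a))
    {P : V → ℝ} (hP : ContDiff ℝ ∞ P) (ℓ : V →L[ℝ] ℝ) (c : ℝ)
    (hLP : ∀ y, ∑ a, w a • fderiv ℝ (fun z => fderiv ℝ P z (E a)) y (E a) = ℓ y + c)
    {φ : V → F} (hφ : ContDiffOn ℝ ∞ φ U) {x : V} (hx : x ∈ U) :
    L (L (L (fun z => P z • φ z))) x - (3 : ℝ) • L (L (fun z => P z • L φ z)) x + (3 : ℝ) • L (fun z => P z • L (L φ) z) x - P x • L (L (L φ)) x =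
      (8 : ℝ) • ∑ a, ∑ b, ∑ c', (w a * w b * w c' * fderiv ℝ (fun z => fderiv ℝ (fun z' => fderiv ℝ P z' (E a)) z (E b)) x (E c')) •
          fderiv ℝ (fun z => fderiv ℝ (fun z' => fderiv ℝ φ z' (E a)) z (E b)) x (E c') := by
  -- the affine function `A = LP`, its derivatives
  have hLPfun : (fun z => ∑ a, w a • fderiv ℝ (fun z' => fderiv ℝ P z' (E a)) z (E a)) = fun z => ℓ z + c := funext hLP
  have hAd : ContDiff ℝ ∞ (fun z => ℓ z + c) := ℓ.contDiff.add contDiff_const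
  have hAder : ∀ z u, fderiv ℝ (fun z => ℓ z + c) z u = ℓ u := fun z u => by
    rw [((ℓ.hasFDerivAt).add_const c).fderiv]
  have hAder2 : ∀ z u v, fderiv ℝ (fun z' => fderiv ℝ (fun z => ℓ z + c) z' u) z v = 0 := fun z u v => by
    simp only [hAder, fderiv_fun_const, Pi.zero_apply, FunLike.coe_zero]
  -- opaque names: the «carré du champ» operators of `P` and of `ℓ`
  obtain ⟨Γ1, hΓ1⟩ : ∃ Γ1 : (V → F) → V → F, Γ1 = fun χ z => ∑ a, w a • (fderiv ℝ P z (E a) • fderiv ℝ χ z (E a)) := ⟨_, rfl⟩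
  obtain ⟨Γ2, hΓ2⟩ : ∃ Γ2 : (V → F) → V → F, Γ2 = fun χ z => ∑ a, ∑ b, (w a * w b * fderiv ℝ (fun z' => fderiv ℝ P z' (E a)) z (E b)) •
      fderiv ℝ (fun z' => fderiv ℝ χ z' (E a)) z (E b) := ⟨_, rfl⟩
  obtain ⟨Γl, hΓl⟩ : ∃ Γl : (V → F) → V → F, Γl = fun χ z => ∑ a, w a • (ℓ (E a) • fderiv ℝ χ z (E a)) := ⟨_, rfl⟩
  -- smoothness transport
  have hPa : ∀ a, ContDiff ℝ ∞ (fun z => fderiv ℝ P z (E a)) := fun a => (hP.fderiv_right (m := ∞) (by simp)).clm_apply contDiff_const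
  have hPab : ∀ a b, ContDiff ℝ ∞ (fun z => fderiv ℝ (fun z' => fderiv ℝ P z' (E a)) z (E b)) := fun a b =>
    ((hPa a).fderiv_right (m := ∞) (by simp)).clm_apply contDiff_const
  have hSL : ∀ {χ : V → F}, ContDiffOn ℝ ∞ χ U → ContDiffOn ℝ ∞ (L χ) U := fun hχ => contDiffOn_weightedSecond hU L hL hχ
  have hSP : ∀ {χ : V → F}, ContDiffOn ℝ ∞ χ U → ContDiffOn ℝ ∞ (fun z => P z • χ z) U := fun hχ => hP.contDiffOn.smul hχ
  have hSA : ∀ {χ : V → F}, ContDiffOn ℝ ∞ χ U → ContDiffOn ℝ ∞ (fun z => (ℓ z + c) • χ z) U := fun hχ => hAd.contDiffOn.smul hχ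
  have hSΓ1 : ∀ {χ : V → F}, ContDiffOn ℝ ∞ χ U → ContDiffOn ℝ ∞ (Γ1 χ) U := fun hχ => by
    rw [hΓ1]
    exact ContDiffOn.sum fun a _ => contDiffOn_const.smul ((hPa a).contDiffOn.smul (contDiffOn_fderiv_apply_const_of_isOpen hU hχ (E a)))
  have hSΓ2 : ∀ {χ : V → F}, ContDiffOn ℝ ∞ χ U → ContDiffOn ℝ ∞ (Γ2 χ) U := fun hχ => by
    rw [hΓ2]
    exact ContDiffOn.sum fun a _ => ContDiffOn.sum fun b _ =>
      (contDiffOn_const.mul (hPab a b).contDiffOn).smul (contDiffOn_fderiv_apply_const_of_isOpen hU (contDiffOn_fderiv_apply_const_of_isOpen hU hχ (E a)) (E b))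
  have hSΓl : ∀ {χ : V → F}, ContDiffOn ℝ ∞ χ U → ContDiffOn ℝ ∞ (Γl χ) U := fun hχ => by
    rw [hΓl]
    exact ContDiffOn.sum fun a _ => contDiffOn_const.smul (contDiffOn_const.smul (contDiffOn_fderiv_apply_const_of_isOpen hU hχ (E a)))
  -- (A) the product rule for `P` and for the affine `ℓ + c`
  have hA1 : ∀ {χ : V → F}, ContDiffOn ℝ ∞ χ U → ∀ {y}, y ∈ U → L (fun z => P z • χ z) y = P y • L χ y + (2 : ℝ) • Γ1 χ y + (ℓ y + c) • χ y := by
    intro χ hχ y hy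
    rw [weightedSecond_smul L hL (hP.contDiffAt.of_le (by norm_cast)) ((hχ.contDiffAt (hU.mem_nhds hy)).of_le (by norm_cast)), hLP y, hΓ1]
  have hA2 : ∀ {χ : V → F}, ContDiffOn ℝ ∞ χ U → ∀ {y}, y ∈ U → L (fun z => (ℓ z + c) • χ z) y = (ℓ y + c) • L χ y + (2 : ℝ) • Γl χ y := by
    intro χ hχ y hy
    rw [weightedSecond_smul L hL (hAd.contDiffAt.of_le (by norm_cast)) ((hχ.contDiffAt (hU.mem_nhds hy)).of_le (by norm_cast)), hΓl]
    simp only [hAder, fderiv_fun_const, Pi.zero_apply, FunLike.coe_zero, smul_zero, Finset.sum_const_zero, zero_smul, add_zero]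
  -- (C) the commutators with `Γ1` and `Γl`
  have hC1 : ∀ {χ : V → F}, ContDiffOn ℝ ∞ χ U → ∀ {y}, y ∈ U → L (Γ1 χ) y = Γ1 (L χ) y + (2 : ℝ) • Γ2 χ y + Γl χ y := by
    intro χ hχ y hy
    rw [hΓ1, hΓ2, hΓl]
    rw [weightedSecond_gamma hU L hL hP hχ hy, hLPfun]
    simp only [hAder]
  have hCl : ∀ {χ : V → F}, ContDiffOn ℝ ∞ χ U → ∀ {y}, y ∈ U → L (Γl χ) y = Γl (L χ) y := by
    intro χ hχ y hy
    rw [hΓl]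
    beta_reduce
    have hfun : (fun z => ∑ a, w a • (ℓ (E a) • fderiv ℝ χ z (E a))) = fun z => ∑ a, (w a * ℓ (E a)) • (fun z' => fderiv ℝ χ z' (E a)) z := by
      funext z
      simp only [smul_smul]
    rw [hfun, weightedSecond_sum_smul hU L hL Finset.univ (fun a => w a * ℓ (E a)) (fun a _ => contDiffOn_fderiv_apply_const_of_isOpen hU hχ (E a)) hy]
    refine Finset.sum_congr rfl fun a _ => ?_
    rw [← fderiv_weightedSecond_apply hU L hL hχ hy (E a), smul_smul]
  -- (D) the commutator with `Γ2`
  have hD1 : ∀ {χ : V → F}, ContDiffOn ℝ ∞ χ U → ∀ {y}, y ∈ U → L (Γ2 χ) y = Γ2 (L χ) y +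
      (2 : ℝ) • ∑ a, ∑ b, ∑ c', (w a * w b * w c' * fderiv ℝ (fun z => fderiv ℝ (fun z' => fderiv ℝ P z' (E a)) z (E b)) y (E c')) •
          fderiv ℝ (fun z => fderiv ℝ (fun z' => fderiv ℝ χ z' (E a)) z (E b)) y (E c') := by
    intro χ hχ y hy
    rw [hΓ2]
    rw [weightedSecond_gammaTwo hU L hL hP hχ hy, hLPfun]
    simp only [hAder2, mul_zero, zero_smul, Finset.sum_const_zero, add_zero]
  -- the square: `L(L(P·χ)) = P·L²χ + 4Γ1(Lχ) + 2(ℓ+c)·Lχ + 4Γ2 χ + 4Γl χ`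
  have hF2 : ∀ {χ : V → F}, ContDiffOn ℝ ∞ χ U → ∀ {y}, y ∈ U → L (L (fun z => P z • χ z)) y =
      P y • L (L χ) y + (4 : ℝ) • Γ1 (L χ) y + (2 : ℝ) • ((ℓ y + c) • L χ y) + (4 : ℝ) • Γ2 χ y + (4 : ℝ) • Γl χ y := by
    intro χ hχ y hy
    have hev : L (fun z => P z • χ z) =ᶠ[𝓝 y] fun z => (P z • L χ z + (2 : ℝ) • Γ1 χ z) + (ℓ z + c) • χ z := by
      filter_upwards [hU.mem_nhds hy] with z hz
      rw [hA1 hχ hz]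
    have h1 : ContDiffOn ℝ ∞ (fun z => P z • L χ z) U := hSP (hSL hχ)
    have h2 : ContDiffOn ℝ ∞ (fun z => (2 : ℝ) • Γ1 χ z) U := contDiffOn_const.smul (hSΓ1 hχ)
    have h12 : ContDiffOn ℝ ∞ (fun z => P z • L χ z + (2 : ℝ) • Γ1 χ z) U := h1.add h2
    have h3 : ContDiffOn ℝ ∞ (fun z => (ℓ z + c) • χ z) U := hSA hχ
    rw [weightedSecond_congr_of_eventuallyEq L hL hev,
      weightedSecond_add hU L hL (χ := fun z => P z • L χ z + (2 : ℝ) • Γ1 χ z) (χ' := fun z => (ℓ z + c) • χ z) h12 h3 hy,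
      weightedSecond_add hU L hL (χ := fun z => P z • L χ z) (χ' := fun z => (2 : ℝ) • Γ1 χ z) h1 h2 hy,
      weightedSecond_const_smul hU L hL 2 (χ := Γ1 χ) (hSΓ1 hχ) hy,
      hA1 (hSL hχ) hy, hC1 hχ hy, hA2 hχ hy]
    module
  -- the cube: `L³(P·φ)` from `hF2` read as an identity of functions near `x`
  have hφ₁ : ContDiffOn ℝ ∞ (L φ) U := hSL hφ
  have hφ₂ : ContDiffOn ℝ ∞ (L (L φ)) U := hSL hφ₁
  have hF3 : L (L (L (fun z => P z • φ z))) x =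
      (P x • L (L (L φ)) x + (2 : ℝ) • Γ1 (L (L φ)) x + (ℓ x + c) • L (L φ) x)
      + (4 : ℝ) • (Γ1 (L (L φ)) x + (2 : ℝ) • Γ2 (L φ) x + Γl (L φ) x)
      + (2 : ℝ) • ((ℓ x + c) • L (L φ) x + (2 : ℝ) • Γl (L φ) x)
      + (4 : ℝ) • (Γ2 (L φ) x + (2 : ℝ) • ∑ a, ∑ b, ∑ c', (w a * w b * w c' * fderiv ℝ (fun z => fderiv ℝ (fun z' => fderiv ℝ P z' (E a)) z (E b)) x (E c')) •
          fderiv ℝ (fun z => fderiv ℝ (fun z' => fderiv ℝ φ z' (E a)) z (E b)) x (E c'))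
      + (4 : ℝ) • Γl (L φ) x := by
    have hev : L (L (fun z => P z • φ z)) =ᶠ[𝓝 x] fun z =>
        ((((P z • L (L φ) z + (4 : ℝ) • Γ1 (L φ) z) + (2 : ℝ) • ((ℓ z + c) • L φ z)) + (4 : ℝ) • Γ2 φ z) + (4 : ℝ) • Γl φ z) := by
      filter_upwards [hU.mem_nhds hx] with z hz
      rw [hF2 hφ hz]
    have h1 : ContDiffOn ℝ ∞ (fun z => P z • L (L φ) z) U := hSP hφ₂
    have h2 : ContDiffOn ℝ ∞ (fun z => (4 : ℝ) • Γ1 (L φ) z) U := contDiffOn_const.smul (hSΓ1 hφ₁)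
    have h3 : ContDiffOn ℝ ∞ (fun z => (2 : ℝ) • ((ℓ z + c) • L φ z)) U := contDiffOn_const.smul (hSA hφ₁)
    have h4 : ContDiffOn ℝ ∞ (fun z => (4 : ℝ) • Γ2 φ z) U := contDiffOn_const.smul (hSΓ2 hφ)
    have h5 : ContDiffOn ℝ ∞ (fun z => (4 : ℝ) • Γl φ z) U := contDiffOn_const.smul (hSΓl hφ)
    have h12 : ContDiffOn ℝ ∞ (fun z => P z • L (L φ) z + (4 : ℝ) • Γ1 (L φ) z) U := h1.add h2
    have h123 : ContDiffOn ℝ ∞ (fun z => P z • L (L φ) z + (4 : ℝ) • Γ1 (L φ) z + (2 : ℝ) • ((ℓ z + c) • L φ z)) U := h12.add h3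
    have h1234 : ContDiffOn ℝ ∞ (fun z => P z • L (L φ) z + (4 : ℝ) • Γ1 (L φ) z + (2 : ℝ) • ((ℓ z + c) • L φ z) + (4 : ℝ) • Γ2 φ z) U := h123.add h4
    rw [weightedSecond_congr_of_eventuallyEq L hL hev,
      weightedSecond_add hU L hL (χ := fun z => P z • L (L φ) z + (4 : ℝ) • Γ1 (L φ) z + (2 : ℝ) • ((ℓ z + c) • L φ z) + (4 : ℝ) • Γ2 φ z)
        (χ' := fun z => (4 : ℝ) • Γl φ z) h1234 h5 hx,
      weightedSecond_add hU L hL (χ := fun z => P z • L (L φ) z + (4 : ℝ) • Γ1 (L φ) z + (2 : ℝ) • ((ℓ z + c) • L φ z))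
        (χ' := fun z => (4 : ℝ) • Γ2 φ z) h123 h4 hx,
      weightedSecond_add hU L hL (χ := fun z => P z • L (L φ) z + (4 : ℝ) • Γ1 (L φ) z) (χ' := fun z => (2 : ℝ) • ((ℓ z + c) • L φ z)) h12 h3 hx,
      weightedSecond_add hU L hL (χ := fun z => P z • L (L φ) z) (χ' := fun z => (4 : ℝ) • Γ1 (L φ) z) h1 h2 hx,
      weightedSecond_const_smul hU L hL 4 (χ := Γ1 (L φ)) (hSΓ1 hφ₁) hx,
      weightedSecond_const_smul hU L hL 2 (χ := fun z => (ℓ z + c) • L φ z) (hSA hφ₁) hx,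
      weightedSecond_const_smul hU L hL 4 (χ := Γ2 φ) (hSΓ2 hφ) hx,
      weightedSecond_const_smul hU L hL 4 (χ := Γl φ) (hSΓl hφ) hx,
      hA1 hφ₂ hx, hC1 hφ₁ hx, hA2 hφ₁ hx, hD1 hφ hx, hCl hφ hx]
  rw [hF3, hF2 hφ₁ hx, hA1 hφ₂ hx]
  module

end Triple

/-! ## §5 The same with `L` and `D³` written through `iteratedFDeriv` (the shape of the (a0) currency `lieLaplacian` ∕ `lieCubic`) -/

section Iterated

variable {G : Type*} [NormedAddCommGroup G] [NormedSpace ℝ G]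
variable {n : ℕ} {E : Fin n → V} {w : Fin n → ℝ} {U : Set V}

/-- Reindexing a triple sum by `(a, b, c) ↦ (c, b, a)`. [folklore] -/
private theorem sum_sum_sum_comm13 {M : Type*} [AddCommMonoid M] (f : Fin n → Fin n → Fin n → M) :
    ∑ a, ∑ b, ∑ c, f a b c = ∑ a, ∑ b, ∑ c, f c b a :=
  calc ∑ a, ∑ b, ∑ c, f a b c = ∑ a, ∑ c, ∑ b, f a b c := Finset.sum_congr rfl fun _ _ => Finset.sum_comm
    _ = ∑ c, ∑ a, ∑ b, f a b c := Finset.sum_comm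
    _ = ∑ c, ∑ b, ∑ a, f a b c := Finset.sum_congr rfl fun _ _ => Finset.sum_comm

/-- `D³ψ(y)(u, v, w) = ∂_u ∂_v ∂_w ψ (y)` (outer slot first — Mathlib's convention) at a point of an open set where `ψ` is smooth. [cite: Dieudonne1960, Ch. VIII §12 (8.12.1)] -/
theorem iteratedFDeriv_three_apply_eq_nested (hU : IsOpen U) {ψ : V → G} (hψ : ContDiffOn ℝ ∞ ψ U) {y : V} (hy : y ∈ U) (u v v' : V) :
    iteratedFDeriv ℝ 3 ψ y ![u, v, v'] = fderiv ℝ (fun z => fderiv ℝ (fun z' => fderiv ℝ ψ z' v') z v) y u := by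
  have hψy : ContDiffAt ℝ ∞ ψ y := hψ.contDiffAt (hU.mem_nhds hy)
  have hd : DifferentiableAt ℝ (iteratedFDeriv ℝ 2 ψ) y := hψy.differentiableAt_iteratedFDeriv (by norm_cast)
  rw [iteratedFDeriv_succ_apply_left]
  have htail : Fin.tail (![u, v, v'] : Fin 3 → V) = ![v, v'] := by
    funext i
    fin_cases i <;> rfl
  rw [htail, show (![u, v, v'] : Fin 3 → V) 0 = u from rfl, ← fderiv_continuousMultilinear_apply_const_apply hd ![v, v'] u]
  have hev : (fun z => iteratedFDeriv ℝ 2 ψ z ![v, v']) =ᶠ[𝓝 y] fun z => fderiv ℝ (fun z' => fderiv ℝ ψ z' v') z v := by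
    filter_upwards [hU.mem_nhds hy] with z hz
    exact iteratedFDeriv_two_apply_eq_fderiv_fderiv_apply ((hψ.contDiffAt (hU.mem_nhds hz)).of_le (by norm_cast)) v v'
  rw [hev.fderiv_eq]

/-- An operator given EVERYWHERE by `Σ_a w_a • D²χ(y)(E_a, E_a)` is LOCAL. [cite: Dieudonne1960, Ch. VIII §12] -/
theorem weightedSecondIterated_congr_of_eventuallyEq (L : (V → G) → V → G) (hL : ∀ χ y, L χ y = ∑ a, w a • iteratedFDeriv ℝ 2 χ y ![E a, E a])
    {χ χ' : V → G} {y : V} (h : χ =ᶠ[𝓝 y] χ') : L χ y = L χ' y := by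
  rw [hL, hL]
  refine Finset.sum_congr rfl fun a _ => ?_
  rw [(h.iteratedFDeriv ℝ 2).eq_of_nhds]

/-- … and agrees, on functions smooth on the open `U`, at points of `U`, with the nested-derivative operator `Σ_a w_a ∂_{E_a}∂_{E_a}`. [cite: Dieudonne1960, Ch. VIII §12 (8.12.1)] -/
theorem weightedSecondIterated_eq_nested (hU : IsOpen U) (L : (V → G) → V → G) (hL : ∀ χ y, L χ y = ∑ a, w a • iteratedFDeriv ℝ 2 χ y ![E a, E a])
    {χ : V → G} (hχ : ContDiffOn ℝ ∞ χ U) {y : V} (hy : y ∈ U) :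
    L χ y = ∑ a, w a • fderiv ℝ (fun z => fderiv ℝ χ z (E a)) y (E a) := by
  rw [hL]
  refine Finset.sum_congr rfl fun a _ => ?_
  rw [iteratedFDeriv_two_apply_eq_fderiv_fderiv_apply ((hχ.contDiffAt (hU.mem_nhds hy)).of_le (by norm_cast))]

/-- **HARISH-CHANDRA'S TRIPLE COMMUTATOR, `iteratedFDeriv` form** (the shape consumed with `L := lieLaplacian`, `hL := fun _ _ => rfl`): for `L χ y = Σ_a w_a • D²χ(y)(E_a,E_a)`
(given EVERYWHERE by this formula), `P` smooth with `Σ_a w_a • D²P(y)(E_a,E_a) = ℓ y + c` affine, `φ` smooth on the open `U ∋ x`: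
`L(L(L(P·φ)))(x) − 3·L(L(P·Lφ))(x) + 3·L(P·L(Lφ))(x) − P(x)·L(L(Lφ))(x) = 8·Σ_{a,b,c} (w_a w_b w_c·D³P(x)(E_a,E_b,E_c)) • D³φ(x)(E_a,E_b,E_c)`.
[cite: HarishChandra1957DiffOps, §§2–3 (the `∂(ω)`-commutators)] [cite: Dieudonne1960, Ch. VIII §12] -/
theorem weightedSecond_tripleCommutator_smul_iteratedFDeriv (hU : IsOpen U) (L : (V → F) → V → F)
    (hL : ∀ χ y, L χ y = ∑ a, w a • iteratedFDeriv ℝ 2 χ y ![E a, E a])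
    {P : V → ℝ} (hP : ContDiff ℝ ∞ P) (ℓ : V →L[ℝ] ℝ) (c : ℝ)
    (hLP : ∀ y, ∑ a, w a • iteratedFDeriv ℝ 2 P y ![E a, E a] = ℓ y + c)
    {φ : V → F} (hφ : ContDiffOn ℝ ∞ φ U) {x : V} (hx : x ∈ U) :
    L (L (L (fun z => P z • φ z))) x - (3 : ℝ) • L (L (fun z => P z • L φ z)) x + (3 : ℝ) • L (fun z => P z • L (L φ) z) x - P x • L (L (L φ)) x =
      (8 : ℝ) • ∑ a, ∑ b, ∑ c', (w a * w b * w c' * iteratedFDeriv ℝ 3 P x ![E a, E b, E c']) • iteratedFDeriv ℝ 3 φ x ![E a, E b, E c'] := by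
  -- the nested-derivative operator `L₀` and its agreement with `L` on `U`
  obtain ⟨L₀, hL₀⟩ : ∃ L₀ : (V → F) → V → F, L₀ = fun χ y => ∑ a, w a • fderiv ℝ (fun z => fderiv ℝ χ z (E a)) y (E a) := ⟨_, rfl⟩
  have hL₀' : ∀ χ y, L₀ χ y = ∑ a, w a • fderiv ℝ (fun z => fderiv ℝ χ z (E a)) y (E a) := fun χ y => by rw [hL₀]
  have hagree : ∀ {χ : V → F}, ContDiffOn ℝ ∞ χ U → ∀ {y}, y ∈ U → L χ y = L₀ χ y := fun {χ} hχ {y} hy => by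
    rw [weightedSecondIterated_eq_nested hU L hL hχ hy, hL₀']
  have hev : ∀ {χ : V → F}, ContDiffOn ℝ ∞ χ U → ∀ {y}, y ∈ U → L χ =ᶠ[𝓝 y] L₀ χ := fun {χ} hχ {y} hy => by
    filter_upwards [hU.mem_nhds hy] with z hz using hagree hχ hz
  have hS₀ : ∀ {χ : V → F}, ContDiffOn ℝ ∞ χ U → ContDiffOn ℝ ∞ (L₀ χ) U := fun hχ => contDiffOn_weightedSecond hU L₀ hL₀' hχ
  have hSP : ∀ {χ : V → F}, ContDiffOn ℝ ∞ χ U → ContDiffOn ℝ ∞ (fun z => P z • χ z) U := fun hχ => hP.contDiffOn.smul hχ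
  -- two-step agreement: `L (L χ) = L₀ (L₀ χ)` on `U`, and three-step at `x`
  have hagree2 : ∀ {χ : V → F}, ContDiffOn ℝ ∞ χ U → ∀ {y}, y ∈ U → L (L χ) y = L₀ (L₀ χ) y := fun {χ} hχ {y} hy => by
    rw [weightedSecondIterated_congr_of_eventuallyEq L hL (hev hχ hy), hagree (hS₀ hχ) hy]
  have hev2 : ∀ {χ : V → F}, ContDiffOn ℝ ∞ χ U → ∀ {y}, y ∈ U → L (L χ) =ᶠ[𝓝 y] L₀ (L₀ χ) := fun {χ} hχ {y} hy => by
    filter_upwards [hU.mem_nhds hy] with z hz using hagree2 hχ hz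
  have hagree3 : ∀ {χ : V → F}, ContDiffOn ℝ ∞ χ U → L (L (L χ)) x = L₀ (L₀ (L₀ χ)) x := fun hχ => by
    rw [weightedSecondIterated_congr_of_eventuallyEq L hL (hev2 hχ hx), hagree (hS₀ (hS₀ hχ)) hx]
  -- the four terms
  have hφ₁ : ContDiffOn ℝ ∞ (L₀ φ) U := hS₀ hφ
  have hφ₂ : ContDiffOn ℝ ∞ (L₀ (L₀ φ)) U := hS₀ hφ₁
  have hPL : (fun z => P z • L φ z) =ᶠ[𝓝 x] fun z => P z • L₀ φ z := by
    filter_upwards [hU.mem_nhds hx] with z hz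
    rw [hagree hφ hz]
  have hPLU : ∀ {y : V}, y ∈ U → L (fun z => P z • L φ z) y = L₀ (fun z => P z • L₀ φ z) y := fun {y} hy => by
    have h : (fun z => P z • L φ z) =ᶠ[𝓝 y] fun z => P z • L₀ φ z := by
      filter_upwards [hU.mem_nhds hy] with z hz
      rw [hagree hφ hz]
    rw [weightedSecondIterated_congr_of_eventuallyEq L hL h, hagree (hSP hφ₁) hy]
  have hT2 : L (L (fun z => P z • L φ z)) x = L₀ (L₀ (fun z => P z • L₀ φ z)) x := by
    have h : L (fun z => P z • L φ z) =ᶠ[𝓝 x] L₀ (fun z => P z • L₀ φ z) := by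
      filter_upwards [hU.mem_nhds hx] with z hz using hPLU hz
    rw [weightedSecondIterated_congr_of_eventuallyEq L hL h, hagree (hS₀ (hSP hφ₁)) hx]
  have hT3 : L (fun z => P z • L (L φ) z) x = L₀ (fun z => P z • L₀ (L₀ φ) z) x := by
    have h : (fun z => P z • L (L φ) z) =ᶠ[𝓝 x] fun z => P z • L₀ (L₀ φ) z := by
      filter_upwards [hU.mem_nhds hx] with z hz
      rw [hagree2 hφ hz]
    rw [weightedSecondIterated_congr_of_eventuallyEq L hL h, hagree (hSP hφ₂) hx]
  have hLP₀ : ∀ y, ∑ a, w a • fderiv ℝ (fun z => fderiv ℝ P z (E a)) y (E a) = ℓ y + c := fun y => by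
    rw [← hLP y]
    refine Finset.sum_congr rfl fun a _ => ?_
    rw [iteratedFDeriv_two_apply_eq_fderiv_fderiv_apply (hP.contDiffAt.of_le (by norm_cast))]
  rw [hagree3 (hSP hφ), hT2, hT3, hagree3 hφ, weightedSecond_tripleCommutator_smul hU L₀ hL₀' hP ℓ c hLP₀ hφ hx]
  -- `∂_c∂_b∂_a = D³(E_c, E_b, E_a)`; relabel the triple sum
  simp only [← iteratedFDeriv_three_apply_eq_nested hU hφ hx, ← iteratedFDeriv_three_apply_eq_nested isOpen_univ hP.contDiffOn (mem_univ x)]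
  congr 1
  refine (sum_sum_sum_comm13 _).trans ?_
  refine Finset.sum_congr rfl fun a _ => Finset.sum_congr rfl fun b _ => Finset.sum_congr rfl fun c' _ => ?_
  congr 1
  ring

end Iterated

end Literature.Analysis.Calculus

end
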